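import Summits.Ventures.PercRepro.S1CoreCapSevenFour

/-!
# PercRepro — TOWARDS `Q*(8)`: FIVE BIG LINES ARE IMPOSSIBLE (p1, gen 27)

At nullity `8`, five lines of `≥ 4` points cannot coexist. The ordering `L₁, L₂, L₃, L₄, L₅` costs
`(|L₁| − 2 + fat) + (|L₂| − 2 + fat) + (|L₃| − 2 + fat) + (|L₄| − max old₄ 2 + fat) + (|L₅| − max old₅ 2 + fat) ≤ 8`
with `old₄ ≤ 3` and `old₅ ≤ 4`, so `max old₄ 2 + max old₅ 2 ≥ 6` (`cost_of_five`): the last line meets the union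
of the other four in `≥ 3` points, and either the fourth line meets the union of the first three in `≥ 3` points
or the fifth meets the union of the other four in `4`. Hence (i) every line meets at
least three of the others, so among any three lines `A, B, C` at most one pair is disjoint — two pairs meet at
a common line — and (ii) some line `X` meets three others `A, B, C` in three distinct points. If `A` meets `B`
and `C`, the list `[C, B, A, X]` has `lineRank 2 + 1 + 0 + 0 = 3` (`B` and `C` each have two old points: their
point on `X` and their point on `A`, distinct because the three points of `X` are) and `≥ 4 + 3 + 2 + 1 = 10`
points — against the plane clause (`ten_points`). `not_five_big` assembles the cases.
`proofs/P1-S4-CAPBRIDGE.md` §19 (B). Axioms: standard.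
-/

namespace PercRepro

namespace S1

namespace FourCap

namespace Eight

open Seven

variable {β : Type} [DecidableEq β]

section FiveBig

variable {w : β → ℕ} {ls : Finset (Finset β)}
  (h1 : ∀ L ∈ ls, ∀ v ∈ L, w v = 1 ∨ w v = 2)
  (h2 : ∀ L ∈ ls, 3 ≤ L.card ∧ wsum w L ≤ 5)
  (h3 : ∀ L ∈ ls, ∀ L' ∈ ls, L ≠ L' → (L ∩ L').card ≤ 1)
  (h4 : ∀ l : List (Finset β), l.Nodup → (∀ L ∈ l, L ∈ ls) → wsum w (unionL l) ≤ 8 + lineRank l)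
  (h5 : ∀ l : List (Finset β), l.Nodup → (∀ L ∈ l, L ∈ ls) → lineRank l ≤ 3 → (unionL l).card ≤ 9)

include h1 h2 h3 h4 in
/-- **The cost of five big lines in one ordering**: with `L₁` placed first and `L₅` last,
`max old₄ 2 + max old₅ 2 ≥ 6`, i.e. the last line meets the union of the other four in `≥ 3` points, and if
the fourth meets the union of the first three in `≤ 2` points then the fifth meets the other four in `4`. -/
theorem cost_of_five {L₁ L₂ L₃ L₄ L₅ : Finset β} (hL₁ : L₁ ∈ ls) (hL₂ : L₂ ∈ ls) (hL₃ : L₃ ∈ ls) (hL₄ : L₄ ∈ ls)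
    (hL₅ : L₅ ∈ ls) (h12 : L₂ ≠ L₁) (h13 : L₃ ≠ L₁) (h14 : L₄ ≠ L₁) (h15 : L₅ ≠ L₁) (h23 : L₃ ≠ L₂)
    (h24 : L₄ ≠ L₂) (h25 : L₅ ≠ L₂) (h34 : L₄ ≠ L₃) (h35 : L₅ ≠ L₃) (h45 : L₅ ≠ L₄)
    (c1 : 4 ≤ L₁.card) (c2 : 4 ≤ L₂.card) (c3 : 4 ≤ L₃.card) (c4 : 4 ≤ L₄.card) (c5 : 4 ≤ L₅.card) :
    3 ≤ (L₅ ∩ (L₄ ∪ (L₃ ∪ (L₂ ∪ L₁)))).card ∧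
      ((L₄ ∩ (L₃ ∪ (L₂ ∪ L₁))).card ≤ 2 → 4 ≤ (L₅ ∩ (L₄ ∪ (L₃ ∪ (L₂ ∪ L₁)))).card) := by
  have hc := costSum_le h1 (two_le_card_of_spec h2) h4 [L₅, L₄, L₃, L₂, L₁]
    (by simp [h12, h13, h14, h15, h23, h24, h25, h34, h35, h45]) (by simp [hL₁, hL₂, hL₃, hL₄, hL₅])
  simp only [costSum, unionL, Finset.union_empty, Nat.zero_add] at hc
  have e1 := lineCost_empty w L₁
  have e2 := lineCost_of_inter_le_two (w := w) (le_trans (h3 L₂ hL₂ L₁ hL₁ h12) (by omega))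
  have e3 := lineCost_of_inter_le_two (w := w) (le_trans (card_inter_union_le L₃ L₂ L₁)
    (by have := h3 L₃ hL₃ L₂ hL₂ h23; have := h3 L₃ hL₃ L₁ hL₁ h13; omega))
  have e4 := lineCost_ge (w := w) L₄ (L₃ ∪ (L₂ ∪ L₁))
  have e5 := lineCost_ge (w := w) L₅ (L₄ ∪ (L₃ ∪ (L₂ ∪ L₁)))
  have i4 : (L₄ ∩ (L₃ ∪ (L₂ ∪ L₁))).card ≤ 3 := le_trans (card_inter_union_le L₄ L₃ (L₂ ∪ L₁))
    (le_trans (Nat.add_le_add_left (card_inter_union_le L₄ L₂ L₁) _)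
      (by have := h3 L₄ hL₄ L₃ hL₃ h34; have := h3 L₄ hL₄ L₂ hL₂ h24; have := h3 L₄ hL₄ L₁ hL₁ h14; omega))
  have i5 : (L₅ ∩ (L₄ ∪ (L₃ ∪ (L₂ ∪ L₁)))).card ≤ 4 := le_trans (card_inter_union_le L₅ L₄ (L₃ ∪ (L₂ ∪ L₁)))
    (le_trans (Nat.add_le_add_left (card_inter_union_le L₅ L₃ (L₂ ∪ L₁)) _)
      (le_trans (Nat.add_le_add_left (Nat.add_le_add_left (card_inter_union_le L₅ L₂ L₁) _) _)
        (by have := h3 L₅ hL₅ L₄ hL₄ h45; have := h3 L₅ hL₅ L₃ hL₃ h35; have := h3 L₅ hL₅ L₂ hL₂ h25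
            have := h3 L₅ hL₅ L₁ hL₁ h15; omega)))
  constructor
  · omega
  · intro h
    omega

include h3 h5 in
/-- **Ten points at rank three**: a big line `X` meeting three big lines `A, B, C` in three distinct points, with
`A` meeting `B` and `C`, gives the list `[C, B, A, X]` of `lineRank 3` with `≥ 10` points. -/
theorem ten_points {X A B C : Finset β} (hX : X ∈ ls) (hA : A ∈ ls) (hB : B ∈ ls) (hC : C ∈ ls)
    (hAX : A ≠ X) (hBX : B ≠ X) (hCX : C ≠ X) (hBA : B ≠ A) (hCA : C ≠ A) (hCB : C ≠ B)
    (cX : 4 ≤ X.card) (cA : 4 ≤ A.card) (cB : 4 ≤ B.card) (cC : 4 ≤ C.card)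
    (hmeet : 3 ≤ (X ∩ (C ∪ (B ∪ A))).card) (hBA1 : 1 ≤ (B ∩ A).card) (hCA1 : 1 ≤ (C ∩ A).card) : False := by
  have pXA := h3 X hX A hA hAX.symm
  have pXB := h3 X hX B hB hBX.symm
  have pXC := h3 X hX C hC hCX.symm
  have pAX := h3 A hA X hX hAX
  have pBX := h3 B hB X hX hBX
  have pCX := h3 C hC X hX hCX
  have pBA := h3 B hB A hA hBA
  have pCA := h3 C hC A hA hCA
  have pCB := h3 C hC B hB hCB
  have iAX : (A ∩ X).card = (X ∩ A).card := by rw [Finset.inter_comm]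
  have iBX : (B ∩ X).card = (X ∩ B).card := by rw [Finset.inter_comm]
  have iCX : (C ∩ X).card = (X ∩ C).card := by rw [Finset.inter_comm]
  -- the three points of `X` on `A, B, C` are distinct: `X ∩ A ∩ B = ∅`, `X ∩ A ∩ C = ∅`
  have jC := card_inter_union_le X C (B ∪ A)
  have jB := card_inter_union_le X B A
  have uBA := Finset.card_union_add_card_inter (X ∩ B) (X ∩ A)
  have eBA : (X ∩ B) ∪ (X ∩ A) = X ∩ (B ∪ A) := (Finset.inter_union_distrib_left X B A).symm
  rw [eBA] at uBA
  have uCA := Finset.card_union_add_card_inter (X ∩ C) (X ∩ A)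
  have eCA : (X ∩ C) ∪ (X ∩ A) = X ∩ (C ∪ A) := (Finset.inter_union_distrib_left X C A).symm
  rw [eCA] at uCA
  have jC' : (X ∩ (C ∪ (B ∪ A))).card ≤ (X ∩ (C ∪ A)).card + (X ∩ B).card := by
    have : X ∩ (C ∪ (B ∪ A)) = X ∩ ((C ∪ A) ∪ B) := by
      congr 1
      ac_rfl
    rw [this]
    exact card_inter_union_le X (C ∪ A) B
  have tBA : (X ∩ B ∩ (X ∩ A)).card = 0 := by omega
  have tCA : (X ∩ C ∩ (X ∩ A)).card = 0 := by omega
  -- `B` has two old points on `A ∪ X`, `C` has two old points on `B ∪ (A ∪ X)`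
  have oB : 2 ≤ (B ∩ (A ∪ X)).card := by
    have u := Finset.card_union_add_card_inter (B ∩ A) (B ∩ X)
    have e : (B ∩ A) ∪ (B ∩ X) = B ∩ (A ∪ X) := (Finset.inter_union_distrib_left B A X).symm
    rw [e] at u
    have e' : (B ∩ A) ∩ (B ∩ X) = X ∩ B ∩ (X ∩ A) := by
      ext v
      simp only [Finset.mem_inter]
      tauto
    rw [e'] at u
    omega
  have oC : 2 ≤ (C ∩ (B ∪ (A ∪ X))).card := by
    have hsub : (C ∩ A) ∪ (C ∩ X) ⊆ C ∩ (B ∪ (A ∪ X)) := by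
      intro v hv
      rcases Finset.mem_union.1 hv with h | h
      · exact Finset.mem_inter.2 ⟨(Finset.mem_inter.1 h).1,
          Finset.mem_union_right _ (Finset.mem_union_left _ (Finset.mem_inter.1 h).2)⟩
      · exact Finset.mem_inter.2 ⟨(Finset.mem_inter.1 h).1,
          Finset.mem_union_right _ (Finset.mem_union_right _ (Finset.mem_inter.1 h).2)⟩
    have u := Finset.card_union_add_card_inter (C ∩ A) (C ∩ X)
    have e' : (C ∩ A) ∩ (C ∩ X) = X ∩ C ∩ (X ∩ A) := by
      ext v
      simp only [Finset.mem_inter]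
      tauto
    rw [e'] at u
    have := Finset.card_le_card hsub
    omega
  have oB' : (B ∩ (A ∪ X)).card ≤ 2 := le_trans (card_inter_union_le B A X) (by omega)
  have oC' : (C ∩ (B ∪ (A ∪ X))).card ≤ 3 := le_trans (card_inter_union_le C B (A ∪ X))
    (le_trans (Nat.add_le_add_left (card_inter_union_le C A X) _) (by omega))
  have oA : (A ∩ X).card = 1 := by omega
  -- the list `[C, B, A, X]`: rank `3`, ten points
  have sA := Finset.card_sdiff_add_card_inter A X
  have sB := Finset.card_sdiff_add_card_inter B (A ∪ X)
  have sC := Finset.card_sdiff_add_card_inter C (B ∪ (A ∪ X))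
  have uA := Finset.card_union_add_card_inter A X
  have uB := Finset.card_union_add_card_inter B (A ∪ X)
  have uC := Finset.card_union_add_card_inter C (B ∪ (A ∪ X))
  have hr := h5 [C, B, A, X] (by simp [hAX, hBX, hCX, hBA, hCA, hCB]) (by simp [hX, hA, hB, hC])
  simp only [lineRank, unionL, Finset.union_empty, Finset.sdiff_empty, Finset.inter_empty, Finset.card_empty,
    Nat.zero_add] at hr
  omega

include h1 h2 h3 h4 h5 in
/-- **Five big lines are impossible at nullity `8`.** -/
theorem not_five_big {L₁ L₂ L₃ L₄ L₅ : Finset β} (hL₁ : L₁ ∈ ls) (hL₂ : L₂ ∈ ls) (hL₃ : L₃ ∈ ls) (hL₄ : L₄ ∈ ls)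
    (hL₅ : L₅ ∈ ls) (h12 : L₂ ≠ L₁) (h13 : L₃ ≠ L₁) (h14 : L₄ ≠ L₁) (h15 : L₅ ≠ L₁) (h23 : L₃ ≠ L₂)
    (h24 : L₄ ≠ L₂) (h25 : L₅ ≠ L₂) (h34 : L₄ ≠ L₃) (h35 : L₅ ≠ L₃) (h45 : L₅ ≠ L₄)
    (c1 : 4 ≤ L₁.card) (c2 : 4 ≤ L₂.card) (c3 : 4 ≤ L₃.card) (c4 : 4 ≤ L₄.card) (c5 : 4 ≤ L₅.card) : False := by
  -- (i) `L₂`, `L₃`, `L₄` each meet at least three of the others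
  have p21 := h3 L₂ hL₂ L₁ hL₁ h12
  have p23 := h3 L₂ hL₂ L₃ hL₃ h23.symm
  have p24 := h3 L₂ hL₂ L₄ hL₄ h24.symm
  have p25 := h3 L₂ hL₂ L₅ hL₅ h25.symm
  have p31 := h3 L₃ hL₃ L₁ hL₁ h13
  have p32 := h3 L₃ hL₃ L₂ hL₂ h23
  have p34 := h3 L₃ hL₃ L₄ hL₄ h34.symm
  have p35 := h3 L₃ hL₃ L₅ hL₅ h35.symm
  have p41 := h3 L₄ hL₄ L₁ hL₁ h14
  have p42 := h3 L₄ hL₄ L₂ hL₂ h24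
  have p43 := h3 L₄ hL₄ L₃ hL₃ h34
  have p45 := h3 L₄ hL₄ L₅ hL₅ h45.symm
  have i23 : (L₂ ∩ L₃).card = (L₃ ∩ L₂).card := by rw [Finset.inter_comm]
  have i24 : (L₂ ∩ L₄).card = (L₄ ∩ L₂).card := by rw [Finset.inter_comm]
  have i34 : (L₃ ∩ L₄).card = (L₄ ∩ L₃).card := by rw [Finset.inter_comm]
  -- `L₂` last
  have m2 := (cost_of_five h1 h2 h3 h4 hL₁ hL₃ hL₄ hL₅ hL₂ h13 h14 h15 h12 h34 h35 h23.symm h45 h24.symm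
    h25.symm c1 c3 c4 c5 c2).1
  have m2' : (L₂ ∩ (L₅ ∪ (L₄ ∪ (L₃ ∪ L₁)))).card ≤
      (L₂ ∩ L₅).card + ((L₂ ∩ L₄).card + ((L₂ ∩ L₃).card + (L₂ ∩ L₁).card)) :=
    le_trans (card_inter_union_le L₂ L₅ (L₄ ∪ (L₃ ∪ L₁)))
      (Nat.add_le_add_left (le_trans (card_inter_union_le L₂ L₄ (L₃ ∪ L₁))
        (Nat.add_le_add_left (card_inter_union_le L₂ L₃ L₁) _)) _)
  -- `L₃` last
  have m3 := (cost_of_five h1 h2 h3 h4 hL₁ hL₂ hL₄ hL₅ hL₃ h12 h14 h15 h13 h24 h25 h23 h45 h34.symm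
    h35.symm c1 c2 c4 c5 c3).1
  have m3' : (L₃ ∩ (L₅ ∪ (L₄ ∪ (L₂ ∪ L₁)))).card ≤
      (L₃ ∩ L₅).card + ((L₃ ∩ L₄).card + ((L₃ ∩ L₂).card + (L₃ ∩ L₁).card)) :=
    le_trans (card_inter_union_le L₃ L₅ (L₄ ∪ (L₂ ∪ L₁)))
      (Nat.add_le_add_left (le_trans (card_inter_union_le L₃ L₄ (L₂ ∪ L₁))
        (Nat.add_le_add_left (card_inter_union_le L₃ L₂ L₁) _)) _)
  -- `L₄` last
  have m4 := (cost_of_five h1 h2 h3 h4 hL₁ hL₂ hL₃ hL₅ hL₄ h12 h13 h15 h14 h23 h25 h24 h35 h34 h45.symm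
    c1 c2 c3 c5 c4).1
  have m4' : (L₄ ∩ (L₅ ∪ (L₃ ∪ (L₂ ∪ L₁)))).card ≤
      (L₄ ∩ L₅).card + ((L₄ ∩ L₃).card + ((L₄ ∩ L₂).card + (L₄ ∩ L₁).card)) :=
    le_trans (card_inter_union_le L₄ L₅ (L₃ ∪ (L₂ ∪ L₁)))
      (Nat.add_le_add_left (le_trans (card_inter_union_le L₄ L₃ (L₂ ∪ L₁))
        (Nat.add_le_add_left (card_inter_union_le L₄ L₂ L₁) _)) _)
  -- (ii) some line `X ∈ {L₁, L₅}` meets `L₂, L₃, L₄` in three distinct points: the ordering `L₂, L₃, L₄, L₁, L₅`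
  have hX : 3 ≤ (L₁ ∩ (L₄ ∪ (L₃ ∪ L₂))).card ∨ 3 ≤ (L₅ ∩ (L₄ ∪ (L₃ ∪ L₂))).card := by
    obtain ⟨-, hf⟩ := cost_of_five h1 h2 h3 h4 hL₂ hL₃ hL₄ hL₁ hL₅ h23 h24 h12.symm h25 h34 h13.symm h35
      h14.symm h45 h15 c2 c3 c4 c1 c5
    by_cases hl : (L₁ ∩ (L₄ ∪ (L₃ ∪ L₂))).card ≤ 2
    · right
      have h4' := hf hl
      have := card_inter_union_le L₅ L₁ (L₄ ∪ (L₃ ∪ L₂))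
      have := h3 L₅ hL₅ L₁ hL₁ h15
      omega
    · left
      omega
  -- (iii) two of the three pairs among `L₂, L₃, L₄` meet at a common line; then `ten_points`
  have hpairs : (1 ≤ (L₃ ∩ L₂).card ∧ 1 ≤ (L₄ ∩ L₂).card) ∨ (1 ≤ (L₂ ∩ L₃).card ∧ 1 ≤ (L₄ ∩ L₃).card) ∨
      (1 ≤ (L₂ ∩ L₄).card ∧ 1 ≤ (L₃ ∩ L₄).card) := by
    omega
  rcases hX with hX | hX <;> rcases hpairs with ⟨hb, hc⟩ | ⟨hb, hc⟩ | ⟨hb, hc⟩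
  · exact ten_points h3 h5 hL₁ hL₂ hL₃ hL₄ h12 h13 h14 h23 h24 h34 c1 c2 c3 c4 hX hb hc
  · have hX' : 3 ≤ (L₁ ∩ (L₄ ∪ (L₂ ∪ L₃))).card := by
      have e : L₄ ∪ (L₃ ∪ L₂) = L₄ ∪ (L₂ ∪ L₃) := by ac_rfl
      rw [← e]; exact hX
    exact ten_points h3 h5 hL₁ hL₃ hL₂ hL₄ h13 h12 h14 h23.symm h34 h24 c1 c3 c2 c4 hX' hb hc
  · have hX' : 3 ≤ (L₁ ∩ (L₃ ∪ (L₂ ∪ L₄))).card := by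
      have e : L₄ ∪ (L₃ ∪ L₂) = L₃ ∪ (L₂ ∪ L₄) := by ac_rfl
      rw [← e]; exact hX
    exact ten_points h3 h5 hL₁ hL₄ hL₂ hL₃ h14 h12 h13 h24.symm h34.symm h23 c1 c4 c2 c3 hX' hb hc
  · exact ten_points h3 h5 hL₅ hL₂ hL₃ hL₄ h25.symm h35.symm h45.symm h23 h24 h34 c5 c2 c3 c4 hX hb hc
  · have hX' : 3 ≤ (L₅ ∩ (L₄ ∪ (L₂ ∪ L₃))).card := by
      have e : L₄ ∪ (L₃ ∪ L₂) = L₄ ∪ (L₂ ∪ L₃) := by ac_rfl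
      rw [← e]; exact hX
    exact ten_points h3 h5 hL₅ hL₃ hL₂ hL₄ h35.symm h25.symm h45.symm h23.symm h34 h24 c5 c3 c2 c4 hX' hb hc
  · have hX' : 3 ≤ (L₅ ∩ (L₃ ∪ (L₂ ∪ L₄))).card := by
      have e : L₄ ∪ (L₃ ∪ L₂) = L₃ ∪ (L₂ ∪ L₄) := by ac_rfl
      rw [← e]; exact hX
    exact ten_points h3 h5 hL₅ hL₄ hL₂ hL₃ h45.symm h25.symm h35.symm h24.symm h34.symm h23 c5 c4 c2 c3 hX' hb hc

end FiveBig

end Eight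

end FourCap

end S1

end PercRepro
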